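/-
Copyright (c) 2026 the pub-hodgecm-mathlib formalisation cell (harness21).  Prover seat hodgecm-mathlib-K2E3-p03 (g4), Track B «K2-LIT» ∕ h413
(`stmt-HodgeConjecture-24833`), line `K2_E3_EllipticInputs`, unit U12, road «GL-[M6]-sc» (line lead K2E3-p23 (g5), deal (M5-3)), brick B4-1d, FILE 2 OF 2:
AN IRREDUCIBLE CHARACTERISTIC POLYNOMIAL MAKES THE CENTRALISER OF `ḡ` IN `G' = GL₃(F) ⧸ ϖ^ℤ·1` COMPACT; THE COMPACTNESS CRITERION AND ITS NORMAL-FORM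
RESTATEMENT (THE CASE SPLIT OF THE NON-ELLIPTIC BRICKS).  2026-09-04.
-/
import Summits.HodgeConjecture.HodgeConjecture.Theorems.K2E3GL3ModUniformizerCentralizerTrichotomy   -- ★ FILE 1 (this seat): trichotomy, `mk_mem_centralizer_mk_iff`, `not_isCompact_centralizer_mk_of_not_irreducible`
import Literature.NumberTheory.Automorphic.ConjugationProperOnRegularCompacta                      -- ★ `exists_eq_sum_smul_pow_of_mem_adjoin`; brings ★ `Literature.LinearAlgebra.Matrix.exists_eq_aeval_of_commute_of_minpoly_eq_charpoly`
import Mathlib.FieldTheory.Minpoly.Field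
import Mathlib.RingTheory.Polynomial.Resultant.Basic
import HarnessLib

/-!
# K2_E3 road (h413), road «GL-[M6]-sc», brick B4-1d (file 2 of 2) — `χ_g` irreducible ⇒ `Z_{G'}(ḡ)` compact; the criterion `Z_{G'}(ḡ) compact ↔ χ_g irreducible`

Cell `pub/hodgecm-mathlib` (D-0151), Track B (21-frontier RULING «PUSH BOTH» 2026-09-03, director req624), seat K2E3-p03 (g4); by-name deal (M5-3) of the
line lead K2E3-p23 (g5), squad bus 2026-09-04T06:18:49Z, heads «=» RULINGS #6 (M6-1) 06:25:32Z.  `--supports stmt-HodgeConjecture-24833 --as helper`;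
THEOREMS ONLY (no definition ∕ instance ∕ notation ∕ named fact ∕ `sorry`); never imports `Cruxes/…/Lines`.  COUNT-NEUTRAL.

THE RESULTS.  §1 (any field `K`, `X : Matrix (Fin m) (Fin m) K` with IRREDUCIBLE characteristic polynomial — then `K[X]` is a field):
* **`minpoly_eq_charpoly_of_irreducible`**, **`exists_eq_sum_smul_pow_of_irreducible`** — the commutant of `X` is `K[X] = {Σ_{k<m} c_k X^k}`
  (★ Horn–Johnson 3.2.4.2 `exists_eq_aeval_of_commute_of_minpoly_eq_charpoly` + Cayley–Hamilton reduction ★ `exists_eq_sum_smul_pow_of_mem_adjoin`);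
* **`isUnit_sum_smul_pow_of_irreducible`** — every NON-ZERO `Σ_{k<m} c_k X^k` is invertible (`p = Σ c_k T^k` is prime to the irreducible `χ_X` since
  `deg p < m`; Bézout + Cayley–Hamilton `χ_X(X) = 0`); `sum_smul_pow_mul_comm`, `sum_mul_smul_pow`, `sum_smul_pow_eq_aeval`, `sum_monomial_ne_zero`,
  `natDegree_sum_monomial_lt`, and (characteristic zero) **`discr_ne_zero_of_separable`** (`disc f ≠ 0` for `f` monic separable: `Res(f, f′) = ± disc f`).
§2 (`[Valued F ℤᵐ⁰]`, `v(ϖ) = exp(−1)`): **`exists_zpow_mul_mem_shell`** — every non-zero coefficient vector `c` rescales by a power of `ϖ` into the compact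
  SHELL `S = {c | ∀ k, v(c_k) ≤ 1, ∃ k, v(c_k) = 1}`.
§3 (`F` a non-archimedean local field, `Valued F ℤᵐ⁰` frame of ★ GL-P ∕ ★ B0a, `G' := GL₃(F) ⧸ ϖ^ℤ·1`):
* **`isCompact_shell`**;
* **`isCompact_centralizer_mk_of_irreducible`** — `χ_g` irreducible ⇒ `Z_{G'}(ḡ)` is COMPACT: by ★ file 1 `mk_mem_centralizer_mk_iff` (no twisted cosets
  mod `ϖ^ℤ`) `Z_{G'}(ḡ) = mk(Z_{GL₃}(g)) = mk(F[g]^×)`, and every `y ∈ F[g]^×` is `ϖ^{-n} · P(c)` with `c ∈ S`, so `Z_{G'}(ḡ) = mk(φ(S))` for the CONTINUOUS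
  `φ : S → GL₃(F)`, `c ↦ P(c) = Σ c_k g^k` (inverse `= det⁻¹ · adj`, continuous since `det P(c) ≠ 0` on `S`) — a continuous image of a compact set;
* **`isCompact_centralizer_mk_iff_irreducible`** — for `χ_g` separable: `Z_{G'}(ḡ)` compact ↔ `χ_g` irreducible (⇒ is ★ file 1);
* **`not_isCompact_centralizer_mk_iff`** (characteristic zero) — the NORMAL-FORM restatement: `Z_{G'}(ḡ)` is non-compact iff `g ~ diag d` (`d` injective,
  ★ J0) or `g ~ M(m)` with irreducible `2 × 2` block (★ file 1 (T3)) — the case split from which the non-elliptic bricks B4-A2 ∕ B4-E2 start.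
[HarishChandra1970, Part VII §3 (an elliptic torus is compact modulo the centre); Cartier1979, §I.3–I.4; HornJohnson2013, Thm. 3.2.4.2; PlatonovRapinchuk1994, §3.3]
HONEST LABEL: HC_CM is proved only modulo the 7 printed citations (2 remaining named inputs: hLiu418 = stmt-HodgeConjecture-24832, h413 =
stmt-HodgeConjecture-24833) until rung 0 closes; count-neutral helper.

## References
* [HarishChandra1970] Harish-Chandra (notes by G. van Dijk), *Harmonic Analysis on Reductive p-adic Groups*, LNM 162 (1970), Part VII §3.
* [Cartier1979] P. Cartier, *Representations of p-adic groups: a survey*, Corvallis (1979), §I.3–I.4.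
* [HornJohnson2013] R. Horn, C. Johnson, *Matrix Analysis*, 2nd ed. (2013), Thm. 3.2.4.2.
* [PlatonovRapinchuk1994] V. Platonov, A. Rapinchuk, *Algebraic Groups and Number Theory* (1994), §3.3.
-/

set_option autoImplicit false
set_option linter.dupNamespace false   -- `Summit.HodgeConjecture.HodgeConjecture.…` (D-0017 nested layout; lakefile exemption for Summits)

noncomputable section

open Polynomial Topology
open scoped Matrix MatrixGroups WithZero
open Literature.NumberTheory.Automorphic
open Summit.HodgeConjecture.HodgeConjecture.Cruxes.H413.K2E3CharpolyRootsPerturbation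
open Summit.HodgeConjecture.HodgeConjecture.Cruxes.H413.K2E3CubicRationalRootsLocallyConstant
open Summit.HodgeConjecture.HodgeConjecture.Cruxes.H413.K2E3GL3ModUniformizerCentralizerTrichotomy

namespace Summit.HodgeConjecture.HodgeConjecture.Cruxes.H413.K2E3GL3ModUniformizerCentralizerCompact

/-! ## §1  `K[X]` is a field when `χ_X` is irreducible: the commutant and the invertibility of its non-zero elements -/

section Algebra

variable {K : Type*} [Field K] {m : ℕ}

/-- An irreducible characteristic polynomial is the minimal polynomial. [cite: HornJohnson2013, Thm. 3.2.4.2] -/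
theorem minpoly_eq_charpoly_of_irreducible [NeZero m] (X : Matrix (Fin m) (Fin m) K) (hirr : Irreducible X.charpoly) : minpoly K X = X.charpoly :=
  (minpoly.eq_of_irreducible_of_monic hirr (Matrix.aeval_self_charpoly X) (Matrix.charpoly_monic X)).symm

/-- **The commutant of `X` with irreducible `χ_X` is `K[X] = {Σ_{k<m} c_k X^k}`.** [cite: HornJohnson2013, Thm. 3.2.4.2] -/
theorem exists_eq_sum_smul_pow_of_irreducible [NeZero m] (X : Matrix (Fin m) (Fin m) K) (hirr : Irreducible X.charpoly) {y : Matrix (Fin m) (Fin m) K}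
    (hy : y * X = X * y) : ∃ c : Fin m → K, y = ∑ k : Fin m, c k • X ^ (k : ℕ) := by
  obtain ⟨p, -, hp⟩ := Literature.LinearAlgebra.Matrix.exists_eq_aeval_of_commute_of_minpoly_eq_charpoly X y
    (minpoly_eq_charpoly_of_irreducible X hirr) hy.symm
  rw [hp]
  exact exists_eq_sum_smul_pow_of_mem_adjoin X (Polynomial.aeval_mem_adjoin_singleton K X)

/-- `Σ c_k X^k` commutes with `X`. [folklore] -/
theorem sum_smul_pow_mul_comm (X : Matrix (Fin m) (Fin m) K) (c : Fin m → K) :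
    (∑ k : Fin m, c k • X ^ (k : ℕ)) * X = X * ∑ k : Fin m, c k • X ^ (k : ℕ) := by
  rw [Finset.sum_mul, Finset.mul_sum]
  refine Finset.sum_congr rfl fun k _ => ?_
  rw [smul_mul_assoc, mul_smul_comm, ← pow_succ, ← pow_succ']

/-- `Σ (t c_k) X^k = t · Σ c_k X^k`. [folklore] -/
theorem sum_mul_smul_pow (X : Matrix (Fin m) (Fin m) K) (c : Fin m → K) (t : K) :
    ∑ k : Fin m, (t * c k) • X ^ (k : ℕ) = t • ∑ k : Fin m, c k • X ^ (k : ℕ) := by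
  rw [Finset.smul_sum]
  exact Finset.sum_congr rfl fun k _ => (smul_smul t (c k) _).symm

/-- `Σ c_k X^k = p(X)` for the polynomial `p = Σ c_k T^k`. [folklore] -/
theorem sum_smul_pow_eq_aeval (X : Matrix (Fin m) (Fin m) K) (c : Fin m → K) :
    ∑ k : Fin m, c k • X ^ (k : ℕ) = aeval X (∑ k : Fin m, Polynomial.monomial (k : ℕ) (c k)) := by
  rw [map_sum]
  refine Finset.sum_congr rfl fun k _ => ?_
  rw [Polynomial.aeval_monomial, Algebra.smul_def]

/-- The polynomial `Σ_{k<m} c_k T^k` is non-zero when `c ≠ 0`. [folklore] -/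
theorem sum_monomial_ne_zero {c : Fin m → K} (hc : c ≠ 0) : (∑ k : Fin m, Polynomial.monomial (k : ℕ) (c k)) ≠ 0 := by
  obtain ⟨k, hk⟩ := Function.ne_iff.1 hc
  intro h
  have hcoeff : (∑ j : Fin m, Polynomial.monomial (j : ℕ) (c j)).coeff k = c k := by
    rw [Polynomial.finsetSum_coeff]
    simp only [Polynomial.coeff_monomial, Fin.val_inj, Finset.sum_ite_eq', Finset.mem_univ, if_true]
  rw [h, Polynomial.coeff_zero] at hcoeff
  exact hk hcoeff.symm

/-- The polynomial `Σ_{k<m} c_k T^k` has degree `< m`. [folklore] -/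
theorem natDegree_sum_monomial_lt (hm : 0 < m) (c : Fin m → K) : (∑ k : Fin m, Polynomial.monomial (k : ℕ) (c k)).natDegree < m := by
  refine lt_of_le_of_lt (Polynomial.natDegree_sum_le_of_forall_le _ _ (n := m - 1) fun k _ => ?_) (by omega)
  exact (Polynomial.natDegree_monomial_le _).trans (by omega)

/-- **Every non-zero element of `K[X]` is invertible when `χ_X` is irreducible**: `p = Σ c_k T^k` (`deg p < m`) is prime to `χ_X`, and Bézout
`a χ_X + b p = 1` evaluated at `X` (Cayley–Hamilton) inverts `p(X)`. [cite: HornJohnson2013, Thm. 3.2.4.2] -/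
theorem isUnit_sum_smul_pow_of_irreducible (X : Matrix (Fin m) (Fin m) K) (hirr : Irreducible X.charpoly) {c : Fin m → K} (hc : c ≠ 0) :
    IsUnit (∑ k : Fin m, c k • X ^ (k : ℕ)) := by
  have hm : 0 < m := by
    obtain ⟨k, -⟩ := Function.ne_iff.1 hc
    exact k.pos
  set p : K[X] := ∑ k : Fin m, Polynomial.monomial (k : ℕ) (c k) with hp
  have hp0 : p ≠ 0 := sum_monomial_ne_zero hc
  have hdeg : p.natDegree < X.charpoly.natDegree := by
    rw [Matrix.charpoly_natDegree_eq_dim, Fintype.card_fin]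
    exact natDegree_sum_monomial_lt hm c
  have hndvd : ¬ X.charpoly ∣ p := fun h => absurd (Polynomial.natDegree_le_of_dvd h hp0) (not_le.2 hdeg)
  obtain ⟨a, b, hab⟩ := hirr.coprime_iff_not_dvd.2 hndvd
  have h1 : aeval X b * aeval X p = 1 := by
    have h := congrArg (Polynomial.aeval X) hab
    rwa [map_add, map_mul, map_mul, Matrix.aeval_self_charpoly, mul_zero, zero_add, map_one] at h
  rw [sum_smul_pow_eq_aeval, ← hp]
  exact (Matrix.isUnit_iff_isUnit_det _).2 (Matrix.isUnit_det_of_left_inverse h1)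

/-- (Characteristic zero) **a monic separable polynomial of positive degree has non-zero discriminant**: `Res(f, f′) = ± lc(f) · disc f` (Mathlib
`resultant_deriv`) and `Res(f, f′) ≠ 0` for `f, f′` coprime. [folklore] -/
theorem discr_ne_zero_of_separable [CharZero K] {f : K[X]} (hf : f.Monic) (hdeg : 0 < f.natDegree) (hsep : f.Separable) : f.discr ≠ 0 := by
  have hres : f.resultant f.derivative ≠ 0 := Polynomial.resultant_ne_zero f f.derivative hsep
  have hd : f.derivative.natDegree = f.natDegree - 1 := Polynomial.natDegree_derivative f
  have hres' : f.resultant f.derivative f.natDegree (f.natDegree - 1) ≠ 0 := by rwa [← hd]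
  rw [Polynomial.resultant_deriv (Polynomial.natDegree_pos_iff_degree_pos.1 hdeg), hf.leadingCoeff, mul_one] at hres'
  exact right_ne_zero_of_mul hres'

end Algebra

/-! ## §2  Rescaling a non-zero coefficient vector into the shell `{max_k v(c_k) = 1}` -/

section Shell

variable {F : Type*} [Field F] [Valued F ℤᵐ⁰]

/-- **Every non-zero `c` rescales by a power of `ϖ` into the shell**: `∃ n, ∀ k, v(ϖ^n c_k) ≤ 1` with equality for some `k`. [folklore] -/
theorem exists_zpow_mul_mem_shell {ι : Type*} [Fintype ι] {ϖ : F} (hϖ : Valued.v ϖ = WithZero.exp (-1 : ℤ)) (c : ι → F) (hc : c ≠ 0) :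
    ∃ n : ℤ, (∀ k, Valued.v (ϖ ^ n * c k) ≤ 1) ∧ ∃ k, Valued.v (ϖ ^ n * c k) = 1 := by
  obtain ⟨k₀, hk₀⟩ := Function.ne_iff.1 hc
  obtain ⟨k₁, -, hmax⟩ := Finset.exists_max_image Finset.univ (fun k => Valued.v (c k)) ⟨k₀, Finset.mem_univ _⟩
  have hne : Valued.v (c k₁) ≠ 0 := by
    intro h0
    have h := hmax k₀ (Finset.mem_univ _)
    rw [h0, le_zero_iff, map_eq_zero] at h
    exact hk₀ h
  have hce : Valued.v (c k₁) = WithZero.exp (WithZero.log (Valued.v (c k₁))) := (WithZero.exp_log hne).symm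
  have hvn : ∀ n : ℤ, Valued.v (ϖ ^ n) = WithZero.exp (-n) := fun n => by
    rw [map_zpow₀, hϖ, ← WithZero.exp_zsmul, smul_eq_mul, mul_neg, mul_one]
  refine ⟨WithZero.log (Valued.v (c k₁)), fun k => ?_, k₁, ?_⟩
  · rw [map_mul, hvn]
    calc WithZero.exp (-WithZero.log (Valued.v (c k₁))) * Valued.v (c k)
        ≤ WithZero.exp (-WithZero.log (Valued.v (c k₁))) * WithZero.exp (WithZero.log (Valued.v (c k₁))) :=
          mul_le_mul' le_rfl ((hmax k (Finset.mem_univ _)).trans hce.le)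
      _ = 1 := by rw [← WithZero.exp_add, neg_add_cancel, WithZero.exp_zero]
  · rw [map_mul, hvn]
    conv_lhs => rw [hce]
    rw [WithZero.log_exp, ← WithZero.exp_add, neg_add_cancel, WithZero.exp_zero]

end Shell

/-! ## §3  `χ_g` irreducible ⇒ `Z_{G'}(ḡ)` compact; the criterion and its normal-form restatement -/

section Compact

variable {F : Type*} [Field F] [Valued F ℤᵐ⁰] [ValuativeRel F] [(Valued.v : Valuation F ℤᵐ⁰).Compatible] [IsNonarchimedeanLocalField F]

/-- The shell `S = {c : F³ | ∀ k, v(c_k) ≤ 1, ∃ k, v(c_k) = 1}` is compact (`𝒪` is compact, the unit sphere is closed). [cite: Cartier1979, §I.3] -/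
theorem isCompact_shell : IsCompact {c : Fin 3 → F | (∀ k, Valued.v (c k) ≤ 1) ∧ ∃ k, Valued.v (c k) = 1} := by
  have hO : IsCompact {x : F | Valued.v x ≤ 1} := by
    have h : {x : F | Valued.v x ≤ 1} = {x : F | ValuativeRel.valuation F x ≤ 1} := Set.ext fun x => v_le_one_iff_valuation_le_one x
    rw [h]
    exact IsNonarchimedeanLocalField.isCompact_closedBall F 1
  have h1 : IsClosed {x : F | Valued.v x = 1} := by
    have h := Valuation.isClosed_sphere (v := (Valued.v : Valuation F ℤᵐ⁰)) 1
    simp only [Valuation.restrict_eq_one_iff] at h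
    exact h
  have hpi : IsCompact {c : Fin 3 → F | ∀ k, Valued.v (c k) ≤ 1} := by
    have h : {c : Fin 3 → F | ∀ k, Valued.v (c k) ≤ 1} = Set.univ.pi fun _ => {x : F | Valued.v x ≤ 1} := by
      ext c
      simp only [Set.mem_setOf_eq, Set.mem_univ_pi]
    rw [h]
    exact isCompact_univ_pi fun _ => hO
  have hcl : IsClosed {c : Fin 3 → F | ∃ k, Valued.v (c k) = 1} := by
    have h : {c : Fin 3 → F | ∃ k, Valued.v (c k) = 1} = ⋃ k, (fun c : Fin 3 → F => c k) ⁻¹' {x : F | Valued.v x = 1} := by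
      ext c
      simp only [Set.mem_setOf_eq, Set.mem_iUnion, Set.mem_preimage]
    rw [h]
    exact isClosed_iUnion_of_finite fun k => h1.preimage (continuous_apply k)
  rw [Set.setOf_and]
  exact hpi.inter_right hcl

/-- **`χ_g` irreducible ⇒ `Z_{G'}(ḡ)` is compact** (`G' = GL₃(F) ⧸ ϖ^ℤ·1`): `Z_{G'}(ḡ) = mk(F[g]^×) = mk(φ(S))` with `φ(c) = Σ c_k g^k` continuous on the
compact shell `S` into `GL₃(F)`.  This is the compactness modulo the centre of the elliptic torus `F[g]^×`.
[cite: HarishChandra1970, Part VII §3; cite: Cartier1979, §I.3–I.4] -/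
theorem isCompact_centralizer_mk_of_irreducible {ϖ : F} (hϖ : Valued.v ϖ = WithZero.exp (-1 : ℤ)) (hϖ0 : ϖ ≠ 0)
    [((Subgroup.zpowers (Units.mk0 ϖ hϖ0)).map (Matrix.GeneralLinearGroup.scalar (Fin 3))).Normal]
    (g : GL (Fin 3) F) (hirr : Irreducible (g : Matrix (Fin 3) (Fin 3) F).charpoly) :
    IsCompact ((Subgroup.centralizer {(QuotientGroup.mk g : GL (Fin 3) F ⧸ (Subgroup.zpowers (Units.mk0 ϖ hϖ0)).map (Matrix.GeneralLinearGroup.scalar (Fin 3)))} :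
      Subgroup (GL (Fin 3) F ⧸ (Subgroup.zpowers (Units.mk0 ϖ hϖ0)).map (Matrix.GeneralLinearGroup.scalar (Fin 3)))) :
        Set (GL (Fin 3) F ⧸ (Subgroup.zpowers (Units.mk0 ϖ hϖ0)).map (Matrix.GeneralLinearGroup.scalar (Fin 3)))) := by
  set X : Matrix (Fin 3) (Fin 3) F := (g : Matrix (Fin 3) (Fin 3) F) with hXdef
  set P : (Fin 3 → F) → Matrix (Fin 3) (Fin 3) F := fun c => ∑ k : Fin 3, c k • X ^ (k : ℕ) with hPdef
  set S : Set (Fin 3 → F) := {c | (∀ k, Valued.v (c k) ≤ 1) ∧ ∃ k, Valued.v (c k) = 1} with hSdef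
  have hS : IsCompact S := isCompact_shell
  have hS0 : ∀ c ∈ S, c ≠ 0 := by
    rintro c ⟨-, k, hk⟩ rfl
    rw [Pi.zero_apply, map_zero] at hk
    exact zero_ne_one hk
  haveI : CompactSpace S := isCompact_iff_compactSpace.1 hS
  have hdet : ∀ c : S, IsUnit (P c).det := fun c => (Matrix.isUnit_iff_isUnit_det _).1 (isUnit_sum_smul_pow_of_irreducible X hirr (hS0 c c.2))
  set φ : S → GL (Fin 3) F := fun c => (P c).nonsingInvUnit (hdet c) with hφdef
  have hφval : ∀ c : S, ((φ c : GL (Fin 3) F) : Matrix (Fin 3) (Fin 3) F) = P c := fun c => rfl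
  -- `φ` is continuous
  have hPc : Continuous fun c : S => P c := by
    show Continuous fun c : S => ∑ k : Fin 3, (c : Fin 3 → F) k • X ^ (k : ℕ)
    exact continuous_finsetSum _ fun k _ => ((continuous_apply k).comp continuous_subtype_val).smul continuous_const
  have hφc : Continuous φ := by
    refine Units.continuous_iff.2 ⟨hPc, ?_⟩
    have h : (fun c : S => (((φ c)⁻¹ : GL (Fin 3) F) : Matrix (Fin 3) (Fin 3) F)) = fun c : S => ((P c).det)⁻¹ • (P c).adjugate := by
      funext c
      rw [Matrix.coe_units_inv, hφval, Matrix.inv_def, Ring.inverse_eq_inv]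
    rw [h]
    exact (hPc.matrix_det.inv₀ fun c => (hdet c).ne_zero).smul hPc.matrix_adjugate
  -- `Z_{G'}(ḡ) = mk(φ(S))`
  have himage : ((Subgroup.centralizer {(QuotientGroup.mk g : GL (Fin 3) F ⧸ (Subgroup.zpowers (Units.mk0 ϖ hϖ0)).map (Matrix.GeneralLinearGroup.scalar (Fin 3)))} :
      Subgroup (GL (Fin 3) F ⧸ (Subgroup.zpowers (Units.mk0 ϖ hϖ0)).map (Matrix.GeneralLinearGroup.scalar (Fin 3)))) :
        Set (GL (Fin 3) F ⧸ (Subgroup.zpowers (Units.mk0 ϖ hϖ0)).map (Matrix.GeneralLinearGroup.scalar (Fin 3)))) =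
      (QuotientGroup.mk : GL (Fin 3) F → GL (Fin 3) F ⧸ (Subgroup.zpowers (Units.mk0 ϖ hϖ0)).map (Matrix.GeneralLinearGroup.scalar (Fin 3))) '' Set.range φ := by
    ext x
    constructor
    · intro hx
      obtain ⟨y, rfl⟩ := QuotientGroup.mk_surjective x
      have hy : y * g = g * y := (mk_mem_centralizer_mk_iff hϖ hϖ0 g y).1 hx
      have hy' : (y : Matrix (Fin 3) (Fin 3) F) * X = X * (y : Matrix (Fin 3) (Fin 3) F) := by
        rw [hXdef, ← Units.val_mul, ← Units.val_mul, hy]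
      obtain ⟨c, hc⟩ := exists_eq_sum_smul_pow_of_irreducible X hirr hy'
      have hc0 : c ≠ 0 := by
        rintro rfl
        have h0 : (y : Matrix (Fin 3) (Fin 3) F) = 0 := by rw [hc]; simp
        exact Matrix.GeneralLinearGroup.det_ne_zero y (by rw [h0, Matrix.det_zero])
      obtain ⟨n, hn, hn1⟩ := exists_zpow_mul_mem_shell hϖ c hc0
      have hc'S : (fun k => ϖ ^ n * c k) ∈ S := ⟨hn, hn1⟩
      refine ⟨φ ⟨fun k => ϖ ^ n * c k, hc'S⟩, ⟨_, rfl⟩, ?_⟩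
      -- `φ(ϖ^n c) = (ϖ^n·1) · y`
      have hval : ((φ ⟨fun k => ϖ ^ n * c k, hc'S⟩ : GL (Fin 3) F) : Matrix (Fin 3) (Fin 3) F) =
          ((Matrix.GeneralLinearGroup.scalar (Fin 3) (Units.mk0 ϖ hϖ0 ^ n) * y : GL (Fin 3) F) : Matrix (Fin 3) (Fin 3) F) := by
        rw [hφval]
        change (∑ k : Fin 3, (ϖ ^ n * c k) • X ^ (k : ℕ)) = _
        rw [sum_mul_smul_pow, Units.val_mul, Matrix.GeneralLinearGroup.coe_scalar, Matrix.scalar_apply, ← Matrix.smul_eq_diagonal_mul,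
          Units.val_zpow_eq_zpow_val, Units.val_mk0, ← hc]
      rw [Units.ext hval, QuotientGroup.mk_mul,
        (QuotientGroup.eq_one_iff _).2 (Subgroup.mem_map_of_mem _ (Subgroup.zpow_mem _ (Subgroup.mem_zpowers _) n)), one_mul]
    · rintro ⟨_, ⟨c, rfl⟩, rfl⟩
      refine (mk_mem_centralizer_mk_iff hϖ hϖ0 g _).2 (Units.ext ?_)
      rw [Units.val_mul, Units.val_mul, hφval]
      exact sum_smul_pow_mul_comm X c
  rw [himage]
  exact (isCompact_range hφc).image QuotientGroup.continuous_mk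

/-- **THE CRITERION: `Z_{G'}(ḡ)` is compact iff `χ_g` is irreducible** (`χ_g` separable; `G' = GL₃(F) ⧸ ϖ^ℤ·1`).  (⇐) `isCompact_centralizer_mk_of_irreducible`;
(⇒) ★ file 1 `not_isCompact_centralizer_mk_of_not_irreducible` (a rational root is simple and gives a split torus direction).
[cite: HarishChandra1970, Part VII §3; cite: Cartier1979, §I.3–I.4] -/
theorem isCompact_centralizer_mk_iff_irreducible {ϖ : F} (hϖ : Valued.v ϖ = WithZero.exp (-1 : ℤ)) (hϖ0 : ϖ ≠ 0)
    [((Subgroup.zpowers (Units.mk0 ϖ hϖ0)).map (Matrix.GeneralLinearGroup.scalar (Fin 3))).Normal]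
    (g : GL (Fin 3) F) (hsep : (g : Matrix (Fin 3) (Fin 3) F).charpoly.Separable) :
    IsCompact ((Subgroup.centralizer {(QuotientGroup.mk g : GL (Fin 3) F ⧸ (Subgroup.zpowers (Units.mk0 ϖ hϖ0)).map (Matrix.GeneralLinearGroup.scalar (Fin 3)))} :
      Subgroup (GL (Fin 3) F ⧸ (Subgroup.zpowers (Units.mk0 ϖ hϖ0)).map (Matrix.GeneralLinearGroup.scalar (Fin 3)))) :
        Set (GL (Fin 3) F ⧸ (Subgroup.zpowers (Units.mk0 ϖ hϖ0)).map (Matrix.GeneralLinearGroup.scalar (Fin 3)))) ↔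
      Irreducible (g : Matrix (Fin 3) (Fin 3) F).charpoly :=
  ⟨fun h => by_contra fun hirr => not_isCompact_centralizer_mk_of_not_irreducible hϖ hϖ0 g hsep hirr h,
    isCompact_centralizer_mk_of_irreducible hϖ hϖ0 g⟩

/-- **THE CASE SPLIT OF THE NON-ELLIPTIC BRICKS** (`χ_g` separable, characteristic zero): `Z_{G'}(ḡ)` is NOT compact iff EITHER `g = h · diag d · h⁻¹` with
`d` injective (three rational eigenvalues, ★ J0) OR `g = h · M(m) · h⁻¹` with `M(m) = !![m 0, m 1, 0; m 2, m 3, 0; 0, 0, m 4]` and the `2 × 2` block having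
irreducible characteristic polynomial (one rational eigenvalue, ★ file 1 (T3)). [cite: HarishChandra1970, Part VII §3; cite: PlatonovRapinchuk1994, §3.3] -/
theorem not_isCompact_centralizer_mk_iff [CharZero F] {ϖ : F} (hϖ : Valued.v ϖ = WithZero.exp (-1 : ℤ)) (hϖ0 : ϖ ≠ 0)
    [((Subgroup.zpowers (Units.mk0 ϖ hϖ0)).map (Matrix.GeneralLinearGroup.scalar (Fin 3))).Normal]
    (g : GL (Fin 3) F) (hsep : (g : Matrix (Fin 3) (Fin 3) F).charpoly.Separable) :
    ¬ IsCompact ((Subgroup.centralizer {(QuotientGroup.mk g : GL (Fin 3) F ⧸ (Subgroup.zpowers (Units.mk0 ϖ hϖ0)).map (Matrix.GeneralLinearGroup.scalar (Fin 3)))} :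
      Subgroup (GL (Fin 3) F ⧸ (Subgroup.zpowers (Units.mk0 ϖ hϖ0)).map (Matrix.GeneralLinearGroup.scalar (Fin 3)))) :
        Set (GL (Fin 3) F ⧸ (Subgroup.zpowers (Units.mk0 ϖ hϖ0)).map (Matrix.GeneralLinearGroup.scalar (Fin 3)))) ↔
      (∃ (h : GL (Fin 3) F) (d : Fin 3 → F), Function.Injective d ∧
          (g : Matrix (Fin 3) (Fin 3) F) = (h : Matrix (Fin 3) (Fin 3) F) * Matrix.diagonal d * ((h⁻¹ : GL (Fin 3) F) : Matrix (Fin 3) (Fin 3) F)) ∨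
        ∃ (h : GL (Fin 3) F) (m : Fin 5 → F), Irreducible (!![m 0, m 1; m 2, m 3] : Matrix (Fin 2) (Fin 2) F).charpoly ∧
          (g : Matrix (Fin 3) (Fin 3) F) = (h : Matrix (Fin 3) (Fin 3) F) * !![m 0, m 1, 0; m 2, m 3, 0; 0, 0, m 4] * ((h⁻¹ : GL (Fin 3) F) : Matrix (Fin 3) (Fin 3) F) := by
  rw [isCompact_centralizer_mk_iff_irreducible hϖ hϖ0 g hsep, irreducible_charpoly_iff_card_roots_eq_zero]
  constructor
  · intro h0
    rcases card_roots_charpoly_eq_zero_or_one_or_three (g : Matrix (Fin 3) (Fin 3) F) with h | h | h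
    · exact absurd h h0
    · exact Or.inr (exists_conj_leviBlock_irreducible_of_card_roots_eq_one _ hsep h)
    · exact Or.inl (exists_conj_diagonal_of_card_roots_eq_three _ h
        (discr_ne_zero_of_separable (Matrix.charpoly_monic _) (by rw [Matrix.charpoly_natDegree_eq_dim, Fintype.card_fin]; norm_num) hsep))
  · rintro (⟨h, d, -, hX⟩ | ⟨h, m, hirr, hX⟩)
    · rw [hX, card_roots_charpoly_conj_diagonal]
      norm_num
    · rw [hX, (irreducible_block_iff_card_roots_eq_one h m).1 hirr]
      norm_num

end Compact

end Summit.HodgeConjecture.HodgeConjecture.Cruxes.H413.K2E3GL3ModUniformizerCentralizerCompact
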